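import Summits.FinalStateConjecture.FinalStateConjecture.Theorems.EIHFluxBalanceInertialRecessionStubCoerMomKernelScaling
import Summits.FinalStateConjecture.FinalStateConjecture.Theorems.EIHFluxBalanceInertialRecessionStubMomRowLinear
import Summits.FinalStateConjecture.FinalStateConjecture.Theorems.EIHFluxBalanceInertialRecessionStubCoerMomQuantRows
import Summits.FinalStateConjecture.FinalStateConjecture.Theorems.EIHFluxBalanceEIHFluxEvaluationKSBoost

/-!
# Route EIHFluxBalance — `InertialRecession` (E′), line `SketchCleanExcision`, skeleton r13,
# stub `stub_coerMomKernel` (Bk), analytic half, part 3: the far-field FAMILY — mass linearity,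
# linearity of the rows in the motion, and the scaled identity

Helper file for the crux `stmt-FinalStateConjecture-17403`
(`Summit.FinalStateConjecture.FinalStateConjecture.Theses.EIHFluxBalance.InertialRecession`, E′),
registered stub `stub_coerMomKernel` (Bk) of skeleton r13 (seat 1, analytic half of Bk).

Bk's hypothesis — the momentum rows of `K + x⁰Var_{(M,a,A,d)}` vanish at all far lab offsets
`y`, `K = boostedKerrBilin L 0 M a` — is rescaled to the unit offset with the Kerr–Schild dilation
(`bk_row_scaling`, part 2): at the fixed slice point `x = (0, y)` the rows of the family
`K_ε = boostedKerrBilin L 0 (εM) (εa)` modulated by `Var_{(εM, εa, ε⁻¹A, d)}` vanish for all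
small `ε = 1/ρ > 0`.  This file separates that identity into its graded pieces:

* `bk_fderiv_kerr_mass`, `bk_var_mass` — **the mass is a linear parameter**:
  `Var_{(M,a,A,d)} = M • Var_{(1,a,A,d)}` (the `η`-terms cancel by skewness of `A`);
* `bk_boostedKerrBilin_zero_mass` — `K_0 = η` (Lorentz invariance of `η`);
* `bk_row_lincomb` — **the rows are linear in the motion** `(A, d)` (ML(i), landed
  `stub_momRowLinear`);
* `bk_scaled_identity` — **the scaled identity**: for every `y ≠ 0` and spatial `e` there is
  `ε₀ > 0` with `row_ε(A, 0) + ε · row_ε(0, d) = 0` for `0 < ε < ε₀`, where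
  `row_ε(A', d') = Ric(K_ε + x⁰Var_{(1,εa,A',d')})(x)(♯dx⁰, e) − Ric(K_ε)(x)(♯dx⁰, e)`
  (`Ric K_ε = 0`, `KSFlux.ricAt_boostedKerr_eq_zero`).

No definitions, no named facts, no `sorry`.
-/

set_option linter.dupNamespace false
set_option maxSynthPendingDepth 3

noncomputable section

open Set Function Filter ContinuousLinearMap Literature.Geometry.Lorentzian
  Literature.Geometry.Lorentzian.MetricCoord
open scoped Topology ContDiff

namespace Summit.FinalStateConjecture.FinalStateConjecture.Theorems.SublinearIsFree.Slaving

/-! ### The mass is a linear parameter -/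

/-- **`Dg_{M,a} = M · Dg_{1,a}` everywhere** (`g_{M,a} = η + M (g_{1,a} − η)`; for `M ≠ 0` the scalar
is invertible, for `M = 0` both sides vanish). [cite: KerrSchild1965, §1] -/
theorem bk_fderiv_kerr_mass (M a : ℝ) (p : E4) :
    fderiv ℝ (Kerr.bilin M a) p = M • fderiv ℝ (Kerr.bilin 1 a) p := by
  rw [KSFlux.kerr_bilin_eq_ksFamily M a, fderiv_const_add]
  by_cases hM : M = 0
  · subst hM
    simp
  · haveI := invertibleOfNonzero hM
    rw [show (fun x : E4 ↦ M • (Kerr.bilin 1 a x - Minkowski.bilin)) =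
        M • (fun x : E4 ↦ Kerr.bilin 1 a x - Minkowski.bilin) from rfl,
      fderiv_const_smul_of_invertible, fderiv_sub_const]

/-- **`Var` is linear in the mass**: for an `η`-skew `A`,
`Var_{(M,a,A,d)}(z) = M • Var_{(1,a,A,d)}(z)` (the terms `η(AS·,S·) + η(S·,AS·)` vanish).
[cite: KerrSchild1965, §1] -/
theorem bk_var_mass (M a : ℝ) (S : E4 →L[ℝ] E4) {A : E4 →L[ℝ] E4}
    (hA : ∀ u w : E4, Minkowski.bilin (A u) w + Minkowski.bilin u (A w) = 0) (d z : E4) :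
    (fderiv ℝ (Kerr.bilin M a) (S z) (A (S z) + d)).bilinearComp S S
        + (Kerr.bilin M a (S z)).bilinearComp (A.comp S) S
        + (Kerr.bilin M a (S z)).bilinearComp S (A.comp S)
      = M • ((fderiv ℝ (Kerr.bilin 1 a) (S z) (A (S z) + d)).bilinearComp S S
        + (Kerr.bilin 1 a (S z)).bilinearComp (A.comp S) S
        + (Kerr.bilin 1 a (S z)).bilinearComp S (A.comp S)) := by
  have hK : ∀ v w : E4, Kerr.bilin M a (S z) v w =
      Minkowski.bilin v w + M * (Kerr.bilin 1 a (S z) v w - Minkowski.bilin v w) := by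
    intro v w
    rw [KSFlux.kerr_bilin_eq_ksFamily M a]
    simp only [_root_.add_apply, _root_.smul_apply, _root_.sub_apply, smul_eq_mul]
  ext u w
  simp only [_root_.add_apply, _root_.smul_apply, ContinuousLinearMap.bilinearComp_apply,
    ContinuousLinearMap.coe_comp, comp_apply, bk_fderiv_kerr_mass M a, smul_eq_mul, hK]
  have h := hA (S u) (S w)
  linear_combination (1 - M) * h

/-- **At zero mass the painted summand is `η`**: `boostedKerrBilin L 0 0 a = η`
(`g_{0,a} = η` and `η(Λ⁻¹·, Λ⁻¹·) = η`). [cite: ONeill1983, Ch. 9, p. 233] -/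
theorem bk_boostedKerrBilin_zero_mass (L : lorentzGroup) (a : ℝ) :
    boostedKerrBilin L 0 0 a = fun _ : E4 ↦ Minkowski.bilin := by
  funext z
  ext v w
  rw [boostedKerrBilin_apply, Kerr.bilin_zero_left]
  have h := L.2 ((L : E4 ≃L[ℝ] E4).symm v) ((L : E4 ≃L[ℝ] E4).symm w)
  rw [ContinuousLinearEquiv.apply_symm_apply, ContinuousLinearEquiv.apply_symm_apply] at h
  exact h.symm

/-! ### The rows are linear in the motion (ML(i)) -/

set_option maxHeartbeats 1600000 in
/-- **The momentum rows of the modulated model are linear in the motion `(A, d)`.** At a slice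
point `x` (`x⁰ = 0`) of the domain of the metric components `G`, with positive painted radius,
the row of `G + x⁰Var_{(c₁A₁ + c₂A₂, c₁d₁ + c₂d₂)}` is `c₁` times the row of
`G + x⁰Var_{(A₁,d₁)}` plus `c₂` times the row of `G + x⁰Var_{(A₂,d₂)}`: `Var` is linear in
`(A, d)`, the three modulated fields are metric components near `x` with the jets of
`coerMomQ_jets_add_slice_smul`, and ML(i) (`stub_momRowLinear`) applies with `n = dx⁰`. [folklore] -/
theorem bk_row_lincomb {G : E4 → E4 →L[ℝ] E4 →L[ℝ] ℝ} {V : Set E4} {x : E4} (hG : IsMetricOn G V)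
    (hxV : x ∈ V) (hx0 : x 0 = 0) (M a : ℝ) (S A₁ A₂ : E4 →L[ℝ] E4) (d₁ d₂ : E4)
    (hx : 0 < Kerr.radius a (S x)) (c₁ c₂ : ℝ) (e : E4) (he : E4.dx 0 e = 0) :
    ricAt (fun z : E4 ↦ G z + (z 0) • ((fderiv ℝ (Kerr.bilin M a) (S z) ((c₁ • A₁ + c₂ • A₂) (S z) + (c₁ • d₁ + c₂ • d₂))).bilinearComp S S + (Kerr.bilin M a (S z)).bilinearComp ((c₁ • A₁ + c₂ • A₂).comp S) S + (Kerr.bilin M a (S z)).bilinearComp S ((c₁ • A₁ + c₂ • A₂).comp S))) x (sharpAt G x (E4.dx 0)) e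
        - ricAt G x (sharpAt G x (E4.dx 0)) e
      = c₁ * (ricAt (fun z : E4 ↦ G z + (z 0) • ((fderiv ℝ (Kerr.bilin M a) (S z) (A₁ (S z) + d₁)).bilinearComp S S + (Kerr.bilin M a (S z)).bilinearComp (A₁.comp S) S + (Kerr.bilin M a (S z)).bilinearComp S (A₁.comp S))) x (sharpAt G x (E4.dx 0)) e
          - ricAt G x (sharpAt G x (E4.dx 0)) e)
        + c₂ * (ricAt (fun z : E4 ↦ G z + (z 0) • ((fderiv ℝ (Kerr.bilin M a) (S z) (A₂ (S z) + d₂)).bilinearComp S S + (Kerr.bilin M a (S z)).bilinearComp (A₂.comp S) S + (Kerr.bilin M a (S z)).bilinearComp S (A₂.comp S))) x (sharpAt G x (E4.dx 0)) e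
          - ricAt G x (sharpAt G x (E4.dx 0)) e) := by
  -- the three first-variation fields
  obtain ⟨Φ₁, hΦ₁⟩ : ∃ Φ : E4 → E4 →L[ℝ] E4 →L[ℝ] ℝ, Φ = fun z ↦ ((fderiv ℝ (Kerr.bilin M a) (S z) (A₁ (S z) + d₁)).bilinearComp S S + (Kerr.bilin M a (S z)).bilinearComp (A₁.comp S) S + (Kerr.bilin M a (S z)).bilinearComp S (A₁.comp S)) := ⟨_, rfl⟩
  obtain ⟨Φ₂, hΦ₂⟩ : ∃ Φ : E4 → E4 →L[ℝ] E4 →L[ℝ] ℝ, Φ = fun z ↦ ((fderiv ℝ (Kerr.bilin M a) (S z) (A₂ (S z) + d₂)).bilinearComp S S + (Kerr.bilin M a (S z)).bilinearComp (A₂.comp S) S + (Kerr.bilin M a (S z)).bilinearComp S (A₂.comp S)) := ⟨_, rfl⟩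
  have h1 : (fun z : E4 ↦ G z + (z 0) • ((fderiv ℝ (Kerr.bilin M a) (S z) (A₁ (S z) + d₁)).bilinearComp S S + (Kerr.bilin M a (S z)).bilinearComp (A₁.comp S) S + (Kerr.bilin M a (S z)).bilinearComp S (A₁.comp S))) = fun z ↦ G z + (z 0) • Φ₁ z := by
    subst hΦ₁; rfl
  have h2 : (fun z : E4 ↦ G z + (z 0) • ((fderiv ℝ (Kerr.bilin M a) (S z) (A₂ (S z) + d₂)).bilinearComp S S + (Kerr.bilin M a (S z)).bilinearComp (A₂.comp S) S + (Kerr.bilin M a (S z)).bilinearComp S (A₂.comp S))) = fun z ↦ G z + (z 0) • Φ₂ z := by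
    subst hΦ₂; rfl
  have h3 : (fun z : E4 ↦ G z + (z 0) • ((fderiv ℝ (Kerr.bilin M a) (S z) ((c₁ • A₁ + c₂ • A₂) (S z) + (c₁ • d₁ + c₂ • d₂))).bilinearComp S S + (Kerr.bilin M a (S z)).bilinearComp ((c₁ • A₁ + c₂ • A₂).comp S) S + (Kerr.bilin M a (S z)).bilinearComp S ((c₁ • A₁ + c₂ • A₂).comp S))) = fun z ↦ G z + (z 0) • (c₁ • Φ₁ z + c₂ • Φ₂ z) := by
    subst hΦ₁ hΦ₂
    funext z
    rw [coerMomQ_var_add, coerMomQ_var_smul, coerMomQ_var_smul]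
  rw [h1, h2, h3]
  -- smoothness and symmetry on `U = {r(S·) > 0}`
  obtain ⟨hU, hΦ₁c⟩ := coerMomQ_contDiffOn_var M a S A₁ d₁
  rw [← hΦ₁] at hΦ₁c
  obtain ⟨-, hΦ₂c⟩ := coerMomQ_contDiffOn_var M a S A₂ d₂
  rw [← hΦ₂] at hΦ₂c
  have hΦ₃c : ContDiffOn ℝ ∞ (fun z ↦ c₁ • Φ₁ z + c₂ • Φ₂ z) {z : E4 | 0 < Kerr.radius a (S z)} :=
    (hΦ₁c.const_smul c₁).add (hΦ₂c.const_smul c₂)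
  have hΦ₁s : ∀ z ∈ {z : E4 | 0 < Kerr.radius a (S z)}, ∀ v w : E4, Φ₁ z v w = Φ₁ z w v :=
    fun z hz v w ↦ by rw [hΦ₁]; exact coerMomQ_var_symm M a S A₁ d₁ hz v w
  have hΦ₂s : ∀ z ∈ {z : E4 | 0 < Kerr.radius a (S z)}, ∀ v w : E4, Φ₂ z v w = Φ₂ z w v :=
    fun z hz v w ↦ by rw [hΦ₂]; exact coerMomQ_var_symm M a S A₂ d₂ hz v w
  have hΦ₃s : ∀ z ∈ {z : E4 | 0 < Kerr.radius a (S z)}, ∀ v w : E4,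
      (c₁ • Φ₁ z + c₂ • Φ₂ z) v w = (c₁ • Φ₁ z + c₂ • Φ₂ z) w v := fun z hz v w ↦ by
    simp only [_root_.add_apply, _root_.smul_apply, smul_eq_mul, hΦ₁s z hz v w, hΦ₂s z hz v w]
  -- a common domain
  obtain ⟨V₁, hV₁o, hxV₁, -, hV₁U, -, hG₁⟩ :=
    coerMomQ_isMetricOn_add_slice_smul hG hxV hx0 hΦ₁c hU hx hΦ₁s
  obtain ⟨V₂, hV₂o, hxV₂, -, -, -, hG₂⟩ :=
    coerMomQ_isMetricOn_add_slice_smul hG hxV hx0 hΦ₂c hU hx hΦ₂s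
  obtain ⟨V₃, hV₃o, hxV₃, hV₃V, -, -, hG₃⟩ :=
    coerMomQ_isMetricOn_add_slice_smul hG hxV hx0 hΦ₃c hU hx hΦ₃s
  set V' : Set E4 := V₁ ∩ V₂ ∩ V₃ with hV'
  have hV'o : IsOpen V' := (hV₁o.inter hV₂o).inter hV₃o
  have hxV' : x ∈ V' := ⟨⟨hxV₁, hxV₂⟩, hxV₃⟩
  have hG' : IsMetricOn G V' := coerMomQ_isMetricOn_mono hG hV'o fun z hz ↦ hV₃V hz.2
  have hG₁' : IsMetricOn (fun z : E4 ↦ G z + (z 0) • Φ₁ z) V' :=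
    coerMomQ_isMetricOn_mono hG₁ hV'o fun z hz ↦ hz.1.1
  have hG₂' : IsMetricOn (fun z : E4 ↦ G z + (z 0) • Φ₂ z) V' :=
    coerMomQ_isMetricOn_mono hG₂ hV'o fun z hz ↦ hz.1.2
  have hG₃' : IsMetricOn (fun z : E4 ↦ G z + (z 0) • (c₁ • Φ₁ z + c₂ • Φ₂ z)) V' :=
    coerMomQ_isMetricOn_mono hG₃ hV'o fun z hz ↦ hz.2
  -- the jets at `x`
  have hV'U : V' ⊆ {z : E4 | 0 < Kerr.radius a (S z)} := fun z hz ↦ hV₁U hz.1.1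
  obtain ⟨h10, h11, h12⟩ :=
    coerMomQ_jets_add_slice_smul hG'.contDiffOn (hΦ₁c.mono hV'U) hV'o hxV' hx0
  obtain ⟨h20, h21, h22⟩ :=
    coerMomQ_jets_add_slice_smul hG'.contDiffOn (hΦ₂c.mono hV'U) hV'o hxV' hx0
  obtain ⟨h30, h31, h32⟩ :=
    coerMomQ_jets_add_slice_smul hG'.contDiffOn (hΦ₃c.mono hV'U) hV'o hxV' hx0
  have hdΦ₁ : DifferentiableAt ℝ Φ₁ x :=
    (hΦ₁c.contDiffAt (hU.mem_nhds hx)).differentiableAt (by simp)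
  have hdΦ₂ : DifferentiableAt ℝ Φ₂ x :=
    (hΦ₂c.contDiffAt (hU.mem_nhds hx)).differentiableAt (by simp)
  have hD3 : fderiv ℝ (fun z ↦ c₁ • Φ₁ z + c₂ • Φ₂ z) x = c₁ • fderiv ℝ Φ₁ x + c₂ • fderiv ℝ Φ₂ x := by
    exact ((hdΦ₁.hasFDerivAt.const_smul c₁).add (hdΦ₂.hasFDerivAt.const_smul c₂)).fderiv
  set n : E4 →L[ℝ] ℝ := E4.dx 0 with hn
  have h31' : fderiv ℝ (fun z : E4 ↦ G z + (z 0) • (c₁ • Φ₁ z + c₂ • Φ₂ z)) x =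
      fderiv ℝ G x + n.smulRight (c₁ • Φ₁ x + c₂ • Φ₂ x) := h31
  have h32' : ∀ v, fderiv ℝ (fderiv ℝ (fun z : E4 ↦ G z + (z 0) • (c₁ • Φ₁ z + c₂ • Φ₂ z))) x v =
      fderiv ℝ (fderiv ℝ G) x v + (n v • (c₁ • fderiv ℝ Φ₁ x + c₂ • fderiv ℝ Φ₂ x)
        + n.smulRight ((c₁ • fderiv ℝ Φ₁ x + c₂ • fderiv ℝ Φ₂ x) v)
        + n v • n.smulRight (0 : E4 →L[ℝ] E4 →L[ℝ] ℝ)) := by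
    intro v
    rw [h32 v, hD3]
  have h := stub_momRowLinear.1 c₁ c₂ hG' hG₁' hG₂' hG₃' hxV' h10 h20 h30 h11 h21 h31' h12 h22
    h32' e he
  exact h

/-! ### The scaled identity -/

set_option maxHeartbeats 1600000 in
/-- **The scaled identity of Bk.** Let `M > 0`, `A` `η`-skew, and suppose the momentum rows of
`K + x⁰Var_{(M,a,A,d)}`, `K = boostedKerrBilin L 0 M a`, vanish at every lab offset `y'` with
`ρ₀ ≤ ‖y'‖` and painted radius `> 2M` (frame operator `S = Λ⁻¹`). Then at every offset `y ≠ 0`,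
for every spatial `e`, there is `ε₀ > 0` such that for `0 < ε < ε₀`, with
`K_ε = boostedKerrBilin L 0 (εM) (εa)`: the painted radius `r_{εa}(S(0,y))` is positive and
`row(K_ε; Var_{(1,εa,A,0)}) + ε · row(K_ε; Var_{(1,εa,0,d)}) = 0` at `x = (0, y)`
(`row(K; Φ) = Ric(K + x⁰Φ)(x)(♯_K dx⁰, e) − Ric(K)(x)(♯_K dx⁰, e)`): the hypothesis at the far
offset `ε⁻¹y` (`coerMomQ_radius_far`), rescaled to `y` (`bk_row_scaling`), reads
`rows(K_ε; Var_{(εM,εa,ε⁻¹A,d)}) = 0`; `Var_{(εM,εa,ε⁻¹A,d)} = Var_{(1,εa,MA,εMd)}` (mass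
linearity), the rows are linear in the motion (`bk_row_lincomb`), and `Ric K_ε = 0`
(`KSFlux.ricAt_boostedKerr_eq_zero`). [folklore] -/
theorem bk_scaled_identity {M a : ℝ} (hM : 0 < M) (L : lorentzGroup) {A : E4 →L[ℝ] E4}
    (hA : ∀ u w : E4, Minkowski.bilin (A u) w + Minkowski.bilin u (A w) = 0) (d : E4) {ρ₀ : ℝ}
    (H : ∀ y : E3, ρ₀ ≤ ‖y‖ → 2 * M < Kerr.radius a (((L : E4 ≃L[ℝ] E4).symm : E4 →L[ℝ] E4) (E4.ofTimeSpace 0 y)) →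
      ∀ e : E4, e 0 = 0 → ricAt (fun z : E4 ↦ boostedKerrBilin L 0 M a z + (z 0) • ((fderiv ℝ (Kerr.bilin M a) (((L : E4 ≃L[ℝ] E4).symm : E4 →L[ℝ] E4) z) (A (((L : E4 ≃L[ℝ] E4).symm : E4 →L[ℝ] E4) z) + d)).bilinearComp ((L : E4 ≃L[ℝ] E4).symm : E4 →L[ℝ] E4) ((L : E4 ≃L[ℝ] E4).symm : E4 →L[ℝ] E4) + (Kerr.bilin M a (((L : E4 ≃L[ℝ] E4).symm : E4 →L[ℝ] E4) z)).bilinearComp (A.comp ((L : E4 ≃L[ℝ] E4).symm : E4 →L[ℝ] E4)) ((L : E4 ≃L[ℝ] E4).symm : E4 →L[ℝ] E4) + (Kerr.bilin M a (((L : E4 ≃L[ℝ] E4).symm : E4 →L[ℝ] E4) z)).bilinearComp ((L : E4 ≃L[ℝ] E4).symm : E4 →L[ℝ] E4) (A.comp ((L : E4 ≃L[ℝ] E4).symm : E4 →L[ℝ] E4)))) (E4.ofTimeSpace 0 y) (sharpAt (boostedKerrBilin L 0 M a) (E4.ofTimeSpace 0 y) (E4.dx 0)) e = 0)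
    {y : E3} (hy : y ≠ 0) {e : E4} (he : e 0 = 0) :
    ∃ ε₀ : ℝ, 0 < ε₀ ∧ ∀ ε : ℝ, 0 < ε → ε < ε₀ →
      0 < Kerr.radius (ε * a) (((L : E4 ≃L[ℝ] E4).symm : E4 →L[ℝ] E4) (E4.ofTimeSpace 0 y)) ∧
      (ricAt (fun z : E4 ↦ boostedKerrBilin L 0 (ε * M) (ε * a) z + (z 0) • ((fderiv ℝ (Kerr.bilin 1 (ε * a)) (((L : E4 ≃L[ℝ] E4).symm : E4 →L[ℝ] E4) z) (A (((L : E4 ≃L[ℝ] E4).symm : E4 →L[ℝ] E4) z) + 0)).bilinearComp ((L : E4 ≃L[ℝ] E4).symm : E4 →L[ℝ] E4) ((L : E4 ≃L[ℝ] E4).symm : E4 →L[ℝ] E4) + (Kerr.bilin 1 (ε * a) (((L : E4 ≃L[ℝ] E4).symm : E4 →L[ℝ] E4) z)).bilinearComp (A.comp ((L : E4 ≃L[ℝ] E4).symm : E4 →L[ℝ] E4)) ((L : E4 ≃L[ℝ] E4).symm : E4 →L[ℝ] E4) + (Kerr.bilin 1 (ε * a) (((L : E4 ≃L[ℝ] E4).symm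 : E4 →L[ℝ] E4) z)).bilinearComp ((L : E4 ≃L[ℝ] E4).symm : E4 →L[ℝ] E4) (A.comp ((L : E4 ≃L[ℝ] E4).symm : E4 →L[ℝ] E4)))) (E4.ofTimeSpace 0 y) (sharpAt (boostedKerrBilin L 0 (ε * M) (ε * a)) (E4.ofTimeSpace 0 y) (E4.dx 0)) e
          - ricAt (boostedKerrBilin L 0 (ε * M) (ε * a)) (E4.ofTimeSpace 0 y) (sharpAt (boostedKerrBilin L 0 (ε * M) (ε * a)) (E4.ofTimeSpace 0 y) (E4.dx 0)) e)
        + ε * (ricAt (fun z : E4 ↦ boostedKerrBilin L 0 (ε * M) (ε * a) z + (z 0) • ((fderiv ℝ (Kerr.bilin 1 (ε * a)) (((L : E4 ≃L[ℝ] E4).symm : E4 →L[ℝ] E4) z) ((0 : E4 →L[ℝ] E4) (((L : E4 ≃L[ℝ] E4).symm : E4 →L[ℝ] E4) z) + d)).bilinearComp ((L : E4 ≃L[ℝ] E4).symm : E4 →L[ℝ] E4) ((L : E4 ≃L[ℝ] E4).symm : E4 →L[ℝ] E4) + (Kerr.bilin 1 (ε * a) (((L : E4 ≃L[ℝ] E4).symm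 : E4 →L[ℝ] E4) z)).bilinearComp ((0 : E4 →L[ℝ] E4).comp ((L : E4 ≃L[ℝ] E4).symm : E4 →L[ℝ] E4)) ((L : E4 ≃L[ℝ] E4).symm : E4 →L[ℝ] E4) + (Kerr.bilin 1 (ε * a) (((L : E4 ≃L[ℝ] E4).symm : E4 →L[ℝ] E4) z)).bilinearComp ((L : E4 ≃L[ℝ] E4).symm : E4 →L[ℝ] E4) ((0 : E4 →L[ℝ] E4).comp ((L : E4 ≃L[ℝ] E4).symm : E4 →L[ℝ] E4)))) (E4.ofTimeSpace 0 y) (sharpAt (boostedKerrBilin L 0 (ε * M) (ε * a)) (E4.ofTimeSpace 0 y) (E4.dx 0)) e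
          - ricAt (boostedKerrBilin L 0 (ε * M) (ε * a)) (E4.ofTimeSpace 0 y) (sharpAt (boostedKerrBilin L 0 (ε * M) (ε * a)) (E4.ofTimeSpace 0 y) (E4.dx 0)) e) = 0 := by
  set S : E4 →L[ℝ] E4 := ((L : E4 ≃L[ℝ] E4).symm : E4 →L[ℝ] E4) with hS
  set x : E4 := E4.ofTimeSpace 0 y with hx
  have hx0 : x 0 = 0 := by simp [hx]
  have hny : 0 < ‖y‖ := norm_pos_iff.2 hy
  -- the threshold: `ε⁻¹ ‖y‖ ≥ max ρ₀ (|a| + (2M + 1))`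
  set R : ℝ := max ρ₀ (|a| + (2 * M + 1)) with hR
  have hRpos : 0 < R := lt_max_of_lt_right (by positivity)
  refine ⟨‖y‖ / R, div_pos hny hRpos, fun ε hε hεlt ↦ ?_⟩
  set ρ : ℝ := ε⁻¹ with hρ
  have hρpos : 0 < ρ := inv_pos.2 hε
  have hρε : ρ⁻¹ = ε := inv_inv ε
  -- the far offset `ρ • y`
  have hfar : R ≤ ‖ρ • y‖ := by
    rw [norm_smul, Real.norm_eq_abs, abs_of_pos hρpos]
    rw [lt_div_iff₀ hRpos] at hεlt
    have hR' : R = ρ * (ε * R) := by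
      rw [hρ, ← mul_assoc, inv_mul_cancel₀ hε.ne', one_mul]
    rw [hR']
    exact mul_le_mul_of_nonneg_left hεlt.le hρpos.le
  have hρ₀ : ρ₀ ≤ ‖ρ • y‖ := (le_max_left _ _).trans hfar
  have hrad : 2 * M < Kerr.radius a (S (E4.ofTimeSpace 0 (ρ • y))) := by
    have h := coerMomQ_radius_far hM.le a L ((le_max_right _ _).trans hfar)
    have hp : poincareInv L 0 (E4.ofTimeSpace 0 (ρ • y)) = S (E4.ofTimeSpace 0 (ρ • y)) := by
      simp [poincareInv, hS]
    rw [hp] at h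
    exact h
  have hpt : E4.ofTimeSpace 0 (ρ • y) = ρ • x := by
    rw [hx, Kerr.smul_ofTimeSpace, mul_zero]
  have hradx : 0 < Kerr.radius a (S (ρ • x)) := by
    rw [← hpt]; linarith
  -- painted radius at `x` for the scaled parameters
  have hrad' : 0 < Kerr.radius (ε * a) (S x) := by
    have h := Kerr.radius_smul hρpos (ρ⁻¹ * a) (S x)
    rw [mul_inv_cancel_left₀ hρpos.ne', ← map_smul] at h
    rw [← hρε]
    rw [h] at hradx
    nlinarith [hradx, hρpos, Kerr.radius_nonneg (ρ⁻¹ * a) (S x)]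
  refine ⟨hrad', ?_⟩
  -- the hypothesis at the far offset, rescaled
  have hH := H (ρ • y) hρ₀ hrad e he
  rw [hpt, bk_row_scaling L M a A d hρpos hx0 hradx e, hρε, mul_eq_zero] at hH
  have hH' := hH.resolve_left (inv_ne_zero (pow_ne_zero 2 hρpos.ne'))
  -- mass linearity: `Var_{(εM,εa,ρA,d)} = Var_{(1,εa, MA + εM·0, M·0 + εM·d)}`
  have hskew : ∀ u w : E4, Minkowski.bilin ((ρ • A) u) w + Minkowski.bilin u ((ρ • A) w) = 0 := by
    intro u w
    simp only [_root_.smul_apply, map_smul, smul_eq_mul]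
    have h := hA u w
    linear_combination ρ * h
  have hA' : (ε * M) • (ρ • A) = M • A + (ε * M) • (0 : E4 →L[ℝ] E4) := by
    rw [smul_zero, add_zero, smul_smul, hρ, mul_comm ε M, mul_assoc, mul_inv_cancel₀ hε.ne',
      mul_one]
  have hd' : (ε * M) • d = M • (0 : E4) + (ε * M) • d := by rw [smul_zero, zero_add]
  have hfield : (fun z : E4 ↦ boostedKerrBilin L 0 (ε * M) (ε * a) z + (z 0) • ((fderiv ℝ (Kerr.bilin (ε * M) (ε * a)) (S z) ((ρ • A) (S z) + d)).bilinearComp S S + (Kerr.bilin (ε * M) (ε * a) (S z)).bilinearComp ((ρ • A).comp S) S + (Kerr.bilin (ε * M) (ε * a) (S z)).bilinearComp S ((ρ • A).comp S)))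
      = fun z : E4 ↦ boostedKerrBilin L 0 (ε * M) (ε * a) z + (z 0) • ((fderiv ℝ (Kerr.bilin 1 (ε * a)) (S z) ((M • A + (ε * M) • (0 : E4 →L[ℝ] E4)) (S z) + (M • (0 : E4) + (ε * M) • d))).bilinearComp S S + (Kerr.bilin 1 (ε * a) (S z)).bilinearComp ((M • A + (ε * M) • (0 : E4 →L[ℝ] E4)).comp S) S + (Kerr.bilin 1 (ε * a) (S z)).bilinearComp S ((M • A + (ε * M) • (0 : E4 →L[ℝ] E4)).comp S)) := by
    funext z
    conv_lhs => rw [bk_var_mass (ε * M) (ε * a) S hskew d z, ← coerMomQ_var_smul, hA', hd']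
  -- `K_ε` is a field of metric components near `x`, and is Ricci-flat there
  have hKm : IsMetricOn (boostedKerrBilin L 0 (ε * M) (ε * a))
      (poincareInv L 0 ⁻¹' (Kerr.region (ε * a) 0 : Set E4)) :=
    bk_isMetricOn_boostedKerrBilin L (ε * M) (ε * a)
  have hxK : x ∈ poincareInv L 0 ⁻¹' (Kerr.region (ε * a) 0 : Set E4) :=
    (bk_mem_region_iff L _ x).2 hrad'
  have hric : ricAt (boostedKerrBilin L 0 (ε * M) (ε * a)) x = 0 := by
    refine KSFlux.ricAt_boostedKerr_eq_zero L 0 (ε * M) (ε * a) ?_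
    have hp : poincareInv L 0 x = S x := by simp [poincareInv, hS]
    rw [hp]
    exact hrad'
  have he' : E4.dx 0 e = 0 := he
  have hlin := bk_row_lincomb hKm hxK hx0 1 (ε * a) S A (0 : E4 →L[ℝ] E4) (0 : E4) d hrad' M
    (ε * M) e he'
  rw [hfield] at hH'
  rw [hH', hric] at hlin
  rw [hric]
  simp only [_root_.zero_apply, sub_zero] at hlin ⊢
  nlinarith [hlin, hM]

/-- **Registered carrier** `bk_family_carrier` of the crux item (one-line form of a lemma of this file,
for the `--supports` protocol). [folklore] -/
theorem bk_family_carrier : open Literature.Geometry.Lorentzian in ∀ (M a : ℝ) (p : E4), fderiv ℝ (Kerr.bilin M a) p = M • fderiv ℝ (Kerr.bilin 1 a) p :=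
  bk_fderiv_kerr_mass

end Summit.FinalStateConjecture.FinalStateConjecture.Theorems.SublinearIsFree.Slaving

end
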